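import Summits.NavierStokesRegularity.NavierStokesRegularity.Theorems.AdaptedFrequencyAdaptedFrequencyConvergesOfRecurrentLiouville
import HarnessLib

/-!
# Crux `AdaptedFrequencyConverges` (stmt-NavierStokesRegularity-10493): glue of the strategist split
  `AdaptedFrequencyConverges ⇐ RecurrentReduction (stmt-1590, PROVED) ∧ RecurrentLiouville (stmt-1589)`

Helper file (`--supports` the crux item; lead prover-line-stmt-NavierStokesRegularity-10493-c20-0, landing the
glue prepared by crux-strategist gen 1, `Cruxes/AdaptedFrequencyConverges/SplitKit.md`, which a planner seat may not
land under `Theorems/`).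

Pure logic over landed theorems:
* `recurrentProfiles_targetOfCruxes_proof` (stmt-1593, PROVED): `RecurrentLiouville → RecurrentReduction → NoTypeIRateProfile`;
* `BirkhoffRecurrentHull.adaptedFrequencyConverges_of_noTypeIRateProfile` (p137229): `NoTypeIRateProfile → AdaptedFrequencyConverges`
  (through `noTypeIBlowup_of_noTypeIRateProfile`, the PROVED profile extraction stmt-1591, and the vacuity certificate
  `CloudFrameEffectiveTsai.adaptedFrequencyConverges_of_noTypeIBlowup`, p121598).

Two forms are recorded: `adaptedFrequencyConverges_of_subs` with the children NAMED
(`Theses.RecurrentProfiles.RecurrentReduction`, `.RecurrentLiouville`), and `adaptedFrequencyConverges_of_subs_inlined`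
whose binder types are the two children statements of `SplitKit.md` / `children.json` VERBATIM (they are the bodies of
the two route definitions, so the two forms are definitionally equal; `recurrentReduction_iff_inlined` /
`recurrentLiouville_iff_inlined` record this by `Iff.rfl`). The planner who replays the split
(`ledger route edit route-NavierStokesRegularity-AdaptedFrequency --split AdaptedFrequencyConverges --into children.json`)
can close its glue item with `--glue-by` either name.
-/

noncomputable section

-- the summit and its single problem share the name (D-0017 nested layout)
set_option linter.dupNamespace false

namespace Summit.NavierStokesRegularity.NavierStokesRegularity.Theorems.AdaptedFrequencyConverges.BirkhoffRecurrentHull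

open Summit.NavierStokesRegularity.NavierStokesRegularity.Theses

/-- **Split glue (named form).** `RecurrentReduction → RecurrentLiouville → AdaptedFrequencyConverges`:
the two children of the strategist split of the crux give `NoTypeIRateProfile` (the proved glue
`recurrentProfiles_targetOfCruxes_proof`, stmt-1593), and `NoTypeIRateProfile` implies the crux
(`adaptedFrequencyConverges_of_noTypeIRateProfile`, p137229: a Type-I blow-up would generate an origin-singular
local-energy Type-I-rate profile, stmt-1591, so the crux's hypotheses become contradictory).
[cite: Furstenberg1981, Thm 1.17; AlbrittonBarker2019, §3] -/
theorem adaptedFrequencyConverges_of_subs : Summit.NavierStokesRegularity.NavierStokesRegularity.Theses.RecurrentProfiles.RecurrentReduction → Summit.NavierStokesRegularity.NavierStokesRegularity.Theses.RecurrentProfiles.RecurrentLiouville → Summit.NavierStokesRegularity.NavierStokesRegularity.Theses.AdaptedFrequency.AdaptedFrequencyConverges :=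
  fun hRR hRL =>
  adaptedFrequencyConverges_of_noTypeIRateProfile
    (Summit.NavierStokesRegularity.NavierStokesRegularity.Theorems.recurrentProfiles_targetOfCruxes_proof hRL hRR)

/-- The first child statement of the split (`children.json`, decl `RecurrentReduction`) is, letter for letter, the
body of `Theses.RecurrentProfiles.RecurrentReduction` (item stmt-NavierStokesRegularity-1590, PROVED). [folklore] -/
theorem recurrentReduction_iff_inlined :
    RecurrentProfiles.RecurrentReduction ↔
      (∀ (u : ℝ → EuclideanSpace ℝ (Fin 3) → EuclideanSpace ℝ (Fin 3)) (p : ℝ → EuclideanSpace ℝ (Fin 3) → ℝ) (G : ℝ → EuclideanSpace ℝ (Fin 3) → EuclideanSpace ℝ (Fin 3) →L[ℝ] EuclideanSpace ℝ (Fin 3)) (C : ℝ), Literature.Analysis.FluidPDE.IsSuitableWeakSolutionOn (Literature.Analysis.FluidPDE.slab (EuclideanSpace ℝ (Fin 3)) (Set.Iio 0) isOpen_Iio) 1 0 u p → Literature.Analysis.FluidPDE.HasWeakSpatialGradientOn (Literature.Analysis.FluidPDE.slab (EuclideanSpace ℝ (Fin 3)) (Set.Iio 0) isOpen_Iio) u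 G → Literature.Analysis.FluidPDE.typeIBound (Set.Iio (0 : ℝ) ×ˢ Set.univ) u p G < ⊤ → Literature.Analysis.FluidPDE.HasTypeITimeDecay C u → Literature.Analysis.FluidPDE.IsBackwardSingularPoint u 0 → ∃ (w : ℝ → EuclideanSpace ℝ (Fin 3) → EuclideanSpace ℝ (Fin 3)) (q : ℝ → EuclideanSpace ℝ (Fin 3) → ℝ) (H : ℝ → EuclideanSpace ℝ (Fin 3) → EuclideanSpace ℝ (Fin 3) →L[ℝ] EuclideanSpace ℝ (Fin 3)), Literature.Analysis.FluidPDE.IsSuitableWeakSolutionOn (Literature.Analysis.FluidPDE.slab (EuclideanSpace ℝ (Fin 3)) (Set.Iio 0) isOpen_Iio) 1 0 w q ∧ Literature.Analysis.FluidPDE.HasWeakSpatialGradientOn (Literature.Analysis.FluidPDE.slab (EuclideanSpace ℝ (Fin 3)) (Set.Iio 0) isOpen_Iio) w H ∧ Literature.Analysis.FluidPDE.typeIBound (Set.Iio (0 : ℝ) ×ˢ Set.univ) w q H < ⊤ ∧ Literature.Analysis.FluidPDE.HasTypeITimeDecay C w ∧ Literature.Analysis.FluidPDE.IsBackwardSingularPoint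 w 0 ∧ (∀ ε : ℝ, 0 < ε → ∀ K : Set (ℝ × EuclideanSpace ℝ (Fin 3)), IsCompact K → K ⊆ Set.Iic (0 : ℝ) ×ˢ Set.univ → ∃ L : ℝ, 0 < L ∧ ∀ a : ℝ, ∃ σ ∈ Set.Icc a (a + L), MeasureTheory.eLpNorm (fun z : ℝ × EuclideanSpace ℝ (Fin 3) => Literature.Analysis.FluidPDE.nsRescale (Real.exp σ) w z.1 z.2 - w z.1 z.2) 3 (MeasureTheory.volume.restrict K) ≤ ENNReal.ofReal ε)) :=
  Iff.rfl

/-- The second child statement of the split (`children.json`, decl `RecurrentLiouville`) is, letter for letter, the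
body of `Theses.RecurrentProfiles.RecurrentLiouville` (item stmt-NavierStokesRegularity-1589, open). [folklore] -/
theorem recurrentLiouville_iff_inlined :
    RecurrentProfiles.RecurrentLiouville ↔
      (∀ (u : ℝ → EuclideanSpace ℝ (Fin 3) → EuclideanSpace ℝ (Fin 3)) (p : ℝ → EuclideanSpace ℝ (Fin 3) → ℝ) (G : ℝ → EuclideanSpace ℝ (Fin 3) → EuclideanSpace ℝ (Fin 3) →L[ℝ] EuclideanSpace ℝ (Fin 3)) (C : ℝ), Literature.Analysis.FluidPDE.IsSuitableWeakSolutionOn (Literature.Analysis.FluidPDE.slab (EuclideanSpace ℝ (Fin 3)) (Set.Iio 0) isOpen_Iio) 1 0 u p → Literature.Analysis.FluidPDE.HasWeakSpatialGradientOn (Literature.Analysis.FluidPDE.slab (EuclideanSpace ℝ (Fin 3)) (Set.Iio 0) isOpen_Iio) u G → Literature.Analysis.FluidPDE.typeIBound (Set.Iio (0 : ℝ) ×ˢ Set.univ) u p G < ⊤ → Literature.Analysis.FluidPDE.HasTypeITimeDecay C u → (∀ ε : ℝ, 0 < ε → ∀ K : Set (ℝ × EuclideanSpace ℝ (Fin 3)),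 IsCompact K → K ⊆ Set.Iic (0 : ℝ) ×ˢ Set.univ → ∃ L : ℝ, 0 < L ∧ ∀ a : ℝ, ∃ σ ∈ Set.Icc a (a + L), MeasureTheory.eLpNorm (fun z : ℝ × EuclideanSpace ℝ (Fin 3) => Literature.Analysis.FluidPDE.nsRescale (Real.exp σ) u z.1 z.2 - u z.1 z.2) 3 (MeasureTheory.volume.restrict K) ≤ ENNReal.ofReal ε) → ¬ Literature.Analysis.FluidPDE.IsBackwardSingularPoint u 0) :=
  Iff.rfl

/-- **Split glue (inlined form).** Same theorem as `adaptedFrequencyConverges_of_subs`, with binder types equal to the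
two children statements of the strategist split VERBATIM (so that a `--glue-by` check against freshly filed children
matches syntactically, not only up to unfolding). [cite: Furstenberg1981, Thm 1.17; AlbrittonBarker2019, §3] -/
theorem adaptedFrequencyConverges_of_subs_inlined :
    (∀ (u : ℝ → EuclideanSpace ℝ (Fin 3) → EuclideanSpace ℝ (Fin 3)) (p : ℝ → EuclideanSpace ℝ (Fin 3) → ℝ) (G : ℝ → EuclideanSpace ℝ (Fin 3) → EuclideanSpace ℝ (Fin 3) →L[ℝ] EuclideanSpace ℝ (Fin 3)) (C : ℝ), Literature.Analysis.FluidPDE.IsSuitableWeakSolutionOn (Literature.Analysis.FluidPDE.slab (EuclideanSpace ℝ (Fin 3)) (Set.Iio 0) isOpen_Iio) 1 0 u p → Literature.Analysis.FluidPDE.HasWeakSpatialGradientOn (Literature.Analysis.FluidPDE.slab (EuclideanSpace ℝ (Fin 3)) (Set.Iio 0) isOpen_Iio) u G → Literature.Analysis.FluidPDE.typeIBound (Set.Iio (0 : ℝ) ×ˢ Set.univ) u p G < ⊤ → Literature.Analysis.FluidPDE.HasTypeITimeDecay C u → Literature.Analysis.FluidPDE.IsBackwardSingularPoint u 0 → ∃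 (w : ℝ → EuclideanSpace ℝ (Fin 3) → EuclideanSpace ℝ (Fin 3)) (q : ℝ → EuclideanSpace ℝ (Fin 3) → ℝ) (H : ℝ → EuclideanSpace ℝ (Fin 3) → EuclideanSpace ℝ (Fin 3) →L[ℝ] EuclideanSpace ℝ (Fin 3)), Literature.Analysis.FluidPDE.IsSuitableWeakSolutionOn (Literature.Analysis.FluidPDE.slab (EuclideanSpace ℝ (Fin 3)) (Set.Iio 0) isOpen_Iio) 1 0 w q ∧ Literature.Analysis.FluidPDE.HasWeakSpatialGradientOn (Literature.Analysis.FluidPDE.slab (EuclideanSpace ℝ (Fin 3)) (Set.Iio 0) isOpen_Iio) w H ∧ Literature.Analysis.FluidPDE.typeIBound (Set.Iio (0 : ℝ) ×ˢ Set.univ) w q H < ⊤ ∧ Literature.Analysis.FluidPDE.HasTypeITimeDecay C w ∧ Literature.Analysis.FluidPDE.IsBackwardSingularPoint w 0 ∧ (∀ ε : ℝ, 0 < ε → ∀ K : Set (ℝ × EuclideanSpace ℝ (Fin 3)), IsCompact K → K ⊆ Set.Iic (0 : ℝ) ×ˢ Set.univ → ∃ L : ℝ, 0 < L ∧ ∀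 a : ℝ, ∃ σ ∈ Set.Icc a (a + L), MeasureTheory.eLpNorm (fun z : ℝ × EuclideanSpace ℝ (Fin 3) => Literature.Analysis.FluidPDE.nsRescale (Real.exp σ) w z.1 z.2 - w z.1 z.2) 3 (MeasureTheory.volume.restrict K) ≤ ENNReal.ofReal ε)) →
    (∀ (u : ℝ → EuclideanSpace ℝ (Fin 3) → EuclideanSpace ℝ (Fin 3)) (p : ℝ → EuclideanSpace ℝ (Fin 3) → ℝ) (G : ℝ → EuclideanSpace ℝ (Fin 3) → EuclideanSpace ℝ (Fin 3) →L[ℝ] EuclideanSpace ℝ (Fin 3)) (C : ℝ), Literature.Analysis.FluidPDE.IsSuitableWeakSolutionOn (Literature.Analysis.FluidPDE.slab (EuclideanSpace ℝ (Fin 3)) (Set.Iio 0) isOpen_Iio) 1 0 u p → Literature.Analysis.FluidPDE.HasWeakSpatialGradientOn (Literature.Analysis.FluidPDE.slab (EuclideanSpace ℝ (Fin 3)) (Set.Iio 0) isOpen_Iio) u G → Literature.Analysis.FluidPDE.typeIBound (Set.Iio (0 : ℝ) ×ˢ Set.univ) u p G < ⊤ → Literature.Analysis.FluidPDE.HasTypeITimeDecay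 C u → (∀ ε : ℝ, 0 < ε → ∀ K : Set (ℝ × EuclideanSpace ℝ (Fin 3)), IsCompact K → K ⊆ Set.Iic (0 : ℝ) ×ˢ Set.univ → ∃ L : ℝ, 0 < L ∧ ∀ a : ℝ, ∃ σ ∈ Set.Icc a (a + L), MeasureTheory.eLpNorm (fun z : ℝ × EuclideanSpace ℝ (Fin 3) => Literature.Analysis.FluidPDE.nsRescale (Real.exp σ) u z.1 z.2 - u z.1 z.2) 3 (MeasureTheory.volume.restrict K) ≤ ENNReal.ofReal ε) → ¬ Literature.Analysis.FluidPDE.IsBackwardSingularPoint u 0) →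
      AdaptedFrequency.AdaptedFrequencyConverges :=
  adaptedFrequencyConverges_of_subs

end Summit.NavierStokesRegularity.NavierStokesRegularity.Theorems.AdaptedFrequencyConverges.BirkhoffRecurrentHull

end
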